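import Summits.BirchSwinnertonDyer.BirchSwinnertonDyer.Theorems.AdditiveBranchIMCMultLowerRankZero
import Summits.BirchSwinnertonDyer.BirchSwinnertonDyer.Theorems.AdditiveBranchIMCMultLowerRankOne
import Summits.BirchSwinnertonDyer.Rank1Residual.Additive.QuadraticBranchLowerDescentSemistable
import HarnessLib

/-!
# Route `AdditiveBranchIMC` (rung K1), crux `MultLower` (item `stmt-BirchSwinnertonDyer-19359`):
# THE CRUX SHAPE — `MultLower` BY NAME from published facts, ONE Λ-adic conjecture and the rank-1 inputs

Cell `bsd-addord`, seat `bsd-addord-k1-c4` (gen 2). Sequel of `AdditiveBranchIMCMultLowerRankZero.lean`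
(p419851) and `…RankOne.lean` (p419598). THEOREMS ONLY (no definition, no named fact, no `sorry`);
every published input is an explicit named-fact binder; nothing is asserted about any curve; cell (M)
stays CONSTRUCTION-shaped; nothing booked.

## What this file records

The crux `MultLower` (`∀ W p, r_an ≤ 1 → N10.CellM W p → MissingLowerBoundAt W p`: odd additive
potentially multiplicative `p`, `E = V ⊗ χ_{p*}` with `V` multiplicative at `p`) is, by modus ponens over
theorems ALREADY in the tree, EXACTLY the following, with NO image hypothesis, NO (ram) hypothesis,
NO unit-coefficient / `μ = 0` certificate and NO base-change object:

* rank `0` (§1, the registered stub `stub_rankZero` = `N10.LowerHalfM` verbatim): the five published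
  facts `hDelX` (Delbourgo 1998 Prop. 4 + §2.2 Lemma (ii) on (M), exact unit form), `hPal` (Pal 2012
  Thm. 3.2, used at `p ≡ 1 (4)` only), `hGZK`, `hmod`, `hmodD`, and ONE Λ-adic input: for every pair of
  cell (M) in analytic rank `0` and every globally minimal twist model `V` (`C • V^{(p*)} = W`, so `V` is
  MULTIPLICATIVE at `p`), the cell's typed conjecture `QuadraticBranchLowerDivisibilityAt V p`
  (b2b seat p10, `Additive/QuadraticBranchLower.lean`: the Skinner–Urban containment
  `ϖ·L_p(f_V, ω^{(p−1)/2}, T) ∣ char_Λ e_{(p−1)/2} X(V/ℚ(μ_{p^∞}))` — the SAME `@[conjecture] def` that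
  types the layer-2 input of the (G-ord, `e = 2`) cruxes 19244/19245, here at a multiplicative instead
  of a good ordinary `V`). Chain: p10's semistable descent to the `T = 0` inputs of both parities
  (`chiBranchLowerLeadingTerm[Odd]At_of_quadraticBranchLower`, no `ord_p j` hypothesis) ∘ p419851's
  `lowerHalfM_of_facts_of_chiBranchLowerLeadingTerm` (X3♯(M) and X4(M) glued).
* rank `1` (§2): Delbourgo 2002 Thm. (A)+(B) on (M) (`hDelM`), `hmod`, `hmodD`, `hGZK`, the same Λ-adic
  input on the rank-`1` pairs, and the one-term mult-branch `p`-adic Gross–Zagier formula with the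
  Schneider rider at every (B)-height datum (`BranchPAdicGrossZagierMultAt W p Dh`, rank `1` OPEN;
  rider I1 of the cell, H3) — p419598 §2 verbatim.
* §3: `MultLower` BY NAME from the two (p419598 §4 ∘ §1).

So the deferred tenure split of 19359 (TARGET E73) can be filed on ONE Λ-adic child
(`∀ (M) pairs, ∀ twist models V, QuadraticBranchLowerDivisibilityAt V p`) + ONE rank-`1` child + a
facts alias, with THIS file's §3 as the glue; the base-change product bound (BC)
(`MultTwistBaseChangeLowerAt`, p421281) and its unit-coefficient certificate are NOT needed for the
lower half (they remain the route to the χ-branch EQUALITY `ChiBranchRatCharEqMult[Odd]At`).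

HONEST LABELS: conditional helper theorems; `QuadraticBranchLowerDivisibilityAt` at a multiplicative
`V` (Skinner–Urban direction on the `ω^{(p−1)/2}`-component of a `p`-MULTIPLICATIVE newform) is NOT in
print at any pair (Skinner 2016 Thm. A / SU 2014 Thm. 3.6.4: trivial component; Wan 2015: `p`
unramified in the totally real field; Fouquet–Wan 2021 Thm. 5.1 hypothesis 2 fails identically on
(M)); `BranchPAdicGrossZagierMultAt` in rank `1` is NOT in print; the rank-`1` class statement is
Schneider-bound. Nothing booked.

References: Delbourgo, Compositio Math. 113 (1998) Prop. 4, §2.2 Lemma (ii), Main Conjecture p. 151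
[Delbourgo1998]; Delbourgo, J. Number Theory 95 (2002) Thm. (A), (B) [Delbourgo2002]; Pal, Proc. AMS
140 (2012) Thm. 3.2 [Pal2012]; Mazur–Tate–Teitelbaum 1986 §I.10, §I.13–I.14
[MazurTateTeitelbaum1986Invent]; Skinner–Urban 2014 Thm. 3.6.4 (shape only) [SkinnerUrban2014];
Miller 2011 Def. 1.1 [Miller2011LMS].
-/

set_option autoImplicit false
set_option linter.dupNamespace false

noncomputable section

open scoped Classical MatrixGroups ModularForm

namespace Summit.BirchSwinnertonDyer.BirchSwinnertonDyer.Theorems.AdditiveBranchIMCMultLower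

open CongruenceSubgroup WeierstrassCurve Literature.NumberTheory.EllipticCurves
  Literature.NumberTheory.EllipticCurves.ModularForms
  Literature.NumberTheory.EllipticCurves.Rank1Residual
  Literature.NumberTheory.EllipticCurves.Rank1Residual.Typed
  Literature.NumberTheory.EllipticCurves.Delbourgo2002
  Summit.BirchSwinnertonDyer.Rank1Residual.Additive
  Summit.BirchSwinnertonDyer.Rank1Residual.AdditivePotMult

/-! ### §1 Rank `0`: the registered stub `stub_rankZero` (= `N10.LowerHalfM`) from the facts and ONE
Λ-adic conjecture on the multiplicative twist models -/

/-- **`stub_rankZero` ≡ `N10.LowerHalfM` from five published facts and the quadratic-branch lower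
divisibility of the multiplicative twist models.** Granted `hDelX` (Delbourgo 1998 Prop. 4 + §2.2
Lemma (ii) on (M), exact), `hPal` (Pal 2012 Thm. 3.2), `hGZK`, `hmod`, `hmodD`: IF for every pair
`(W, p)` of cell (M) in analytic rank `0` every globally minimal twist model `V` with `C • V^{(p*)} = W`
satisfies `QuadraticBranchLowerDivisibilityAt V p` (Λ-adic, `ω^{(p−1)/2}`-component of the
`p`-multiplicative newform `f_V`; NOT in print), THEN `N10.LowerHalfM`. Proof: p10's semistable descent
to the `T = 0` branch inputs of both parities, then p419851 §2. No image / (ram) / certificate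
hypothesis. Conditional; nothing booked.
[cite: Delbourgo1998, Prop. 4 (p. 144), §2.2 Lemma (ii) (p. 139), Main Conjecture (p. 151) (shape)]
[cite: Pal2012, Thm. 3.2] [cite: MazurTateTeitelbaum1986Invent, §I.13–I.14]
[cite: SkinnerUrban2014, Thm. 3.6.4 (p. 43) (shape only; nothing asserted)] -/
theorem lowerHalfM_of_facts_of_quadraticBranchLower
    (hDelX : Delbourgo1998.prop4_rankZero_constantCoeff_eq_unit_mul_of_potMult)
    (hPal : Pal2012.thm32_sqrt_mul_realPeriodRat_twist_eq_of_prime_one_mod_four)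
    (hGZK : rank_eq_analyticRank_of_analyticRank_le_one) (hmod : hasEntireLFunction_rat)
    (hmodD : nonempty_modularParametrizationData)
    (hΛ : ∀ (W : WeierstrassCurve ℚ) [W.IsElliptic] [W.IsGloballyMinimal] (p : ℕ) [Fact p.Prime],
      N10.CellM W p → W.analyticRank = 0 →
      ∀ (V : WeierstrassCurve ℚ) [V.IsElliptic] [V.IsGloballyMinimal],
        (∃ C : VariableChange ℚ, C • V.quadraticTwist ((-1) ^ (p / 2) * p : ℚ) = W) →
          QuadraticBranchLowerDivisibilityAt V p) :
    N10.LowerHalfM :=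
  lowerHalfM_of_facts_of_chiBranchLowerLeadingTerm hDelX hPal hGZK hmod hmodD
    fun W _ _ p _ hc hr =>
      ⟨fun _ => chiBranchLowerLeadingTermAt_of_quadraticBranchLower W p (hΛ W p hc hr),
        fun _ => chiBranchLowerLeadingTermOddAt_of_quadraticBranchLower W p (hΛ W p hc hr)⟩

/-- **The registered stub `stub_rankZero`, verbatim signature, MODULO the displayed inputs** (same
content as `lowerHalfM_of_facts_of_quadraticBranchLower`, spelled as the BC3 skeleton registers it).
[cite: Delbourgo1998, Main Conjecture (p. 151) (shape)] [cite: Miller2011LMS, Def. 1.1] -/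
theorem stub_rankZero_of_facts_of_quadraticBranchLower
    (hDelX : Delbourgo1998.prop4_rankZero_constantCoeff_eq_unit_mul_of_potMult)
    (hPal : Pal2012.thm32_sqrt_mul_realPeriodRat_twist_eq_of_prime_one_mod_four)
    (hGZK : rank_eq_analyticRank_of_analyticRank_le_one) (hmod : hasEntireLFunction_rat)
    (hmodD : nonempty_modularParametrizationData)
    (hΛ : ∀ (W : WeierstrassCurve ℚ) [W.IsElliptic] [W.IsGloballyMinimal] (p : ℕ) [Fact p.Prime],
      N10.CellM W p → W.analyticRank = 0 →
      ∀ (V : WeierstrassCurve ℚ) [V.IsElliptic] [V.IsGloballyMinimal],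
        (∃ C : VariableChange ℚ, C • V.quadraticTwist ((-1) ^ (p / 2) * p : ℚ) = W) →
          QuadraticBranchLowerDivisibilityAt V p) :
    ∀ (W : WeierstrassCurve ℚ) [W.IsElliptic] [W.IsGloballyMinimal] (p : ℕ) [Fact p.Prime],
      W.analyticRank = 0 → N10.CellM W p → MissingLowerBoundAt W p :=
  stub_rankZero_iff_lowerHalfM.mpr
    (lowerHalfM_of_facts_of_quadraticBranchLower hDelX hPal hGZK hmod hmodD hΛ)

/-- **Per pair, rank `0`**: at ONE pair `(W, p)` of cell (M) with `r_an = 0`, the Λ-adic input for its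
own twist models suffices (X3♯(M) / X4(M) cases of p07's transport glued by
`N10.cellM_iff_classX3M_or_classX4M`; parity split discharged). Facts `hDelX hPal hGZK hmod hmodD`.
[cite: Delbourgo1998, Prop. 4 (p. 144), §2.2 Lemma (ii) (p. 139)] [cite: Pal2012, Thm. 3.2] -/
theorem missingLowerBoundAt_rankZero_of_cellM_of_quadraticBranchLower
    {W : WeierstrassCurve ℚ} [W.IsElliptic] [W.IsGloballyMinimal] {p : ℕ} [Fact p.Prime]
    (hDelX : Delbourgo1998.prop4_rankZero_constantCoeff_eq_unit_mul_of_potMult)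
    (hPal : Pal2012.thm32_sqrt_mul_realPeriodRat_twist_eq_of_prime_one_mod_four)
    (hGZK : rank_eq_analyticRank_of_analyticRank_le_one) (hmod : hasEntireLFunction_rat)
    (hmodD : nonempty_modularParametrizationData)
    (hc : N10.CellM W p) (hr : W.analyticRank = 0)
    (hΛ : ∀ (V : WeierstrassCurve ℚ) [V.IsElliptic] [V.IsGloballyMinimal],
      (∃ C : VariableChange ℚ, C • V.quadraticTwist ((-1) ^ (p / 2) * p : ℚ) = W) →
        QuadraticBranchLowerDivisibilityAt V p) :
    MissingLowerBoundAt W p := by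
  have hodd : p % 4 = 1 ∨ p % 4 = 3 := by
    obtain ⟨k, hk⟩ := (Fact.out : p.Prime).odd_of_ne_two hc.1
    omega
  have h1 := chiBranchLowerLeadingTermAt_of_quadraticBranchLower W p hΛ
  have h3 := chiBranchLowerLeadingTermOddAt_of_quadraticBranchLower W p hΛ
  rcases (N10.cellM_iff_classX3M_or_classX4M W p).mp hc with hX | hX
  · rcases hodd with h | h
    · exact hX.missingLowerBoundAt_rankZero_of_chiBranchLower hDelX hPal hGZK hmod hmodD h hr h1
    · exact hX.missingLowerBoundAt_rankZero_of_chiBranchLowerOdd hDelX hGZK hmod hmodD h hr h3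
  · rcases hodd with h | h
    · exact hX.missingLowerBoundAt_rankZero_of_chiBranchLower hDelX hPal hGZK hmod hmodD h hr h1
    · exact hX.missingLowerBoundAt_rankZero_of_chiBranchLowerOdd hDelX hGZK hmod hmodD h hr h3

/-! ### §2 Rank `1`: the registered stub `stub_rankOne` MODULO the displayed inputs is ALREADY the
tree's `multLower_rankOne_of_facts_of_quadraticBranchLower_of_branchPAdicGrossZagierMult` (p419598 §2:
`hDelM`, `hmod`, `hmodD`, `hGZK`; the same Λ-adic input on the rank-`1` pairs; the Schneider rider and
`BranchPAdicGrossZagierMultAt W p Dh` at every (B)-height datum) — not restated here. -/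

/-! ### §3 THE CRUX SHAPE: `MultLower` BY NAME -/

/-- **THE CRUX SHAPE of item 19359.** `MultLower` BY NAME from: SIX published facts — `hDelX`
(Delbourgo 1998 Prop. 4 + §2.2 Lemma (ii) on (M), exact unit form), `hPal` (Pal 2012 Thm. 3.2),
`hDelM` (Delbourgo 2002 Thm. (A)+(B) on (M)), `hGZK` (Gross–Zagier–Kolyvagin), `hmod` (modularity),
`hmodD` (a modular parametrisation); ONE Λ-adic conjecture — `QuadraticBranchLowerDivisibilityAt V p`
for every globally minimal multiplicative twist model `V` of every pair of cell (M) in analytic rank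
`≤ 1` (the Skinner–Urban containment on the `ω^{(p−1)/2}`-component of the `p`-multiplicative newform
`f_V`; the literal (M)-twin of the layer of cruxes 19244/19245; NOT in print); and the rank-`1` inputs
at every (B)-height datum of every rank-`1` pair — the Schneider rider and the one-term mult-branch
`p`-adic Gross–Zagier `BranchPAdicGrossZagierMultAt W p Dh` (rank `1` OPEN). NO image, (ram),
Tamagawa, Manin, unit-coefficient or base-change hypothesis. Composition: p419598 §4 over §1.
Conditional; cell (M) stays CONSTRUCTION-shaped; nothing booked.
[cite: Delbourgo1998, Prop. 4 (p. 144), §2.2 Lemma (ii) (p. 139), Main Conjecture (p. 151) (shape)]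
[cite: Delbourgo2002, Theorem (A), (B) (p. 40)] [cite: Pal2012, Thm. 3.2]
[cite: SkinnerUrban2014, Thm. 3.6.4 (p. 43) (shape only; nothing asserted)] [cite: Miller2011LMS, Def. 1.1] -/
theorem multLower_of_facts_of_quadraticBranchLower_of_branchPAdicGrossZagierMult
    (hDelX : Delbourgo1998.prop4_rankZero_constantCoeff_eq_unit_mul_of_potMult)
    (hPal : Pal2012.thm32_sqrt_mul_realPeriodRat_twist_eq_of_prime_one_mod_four)
    (hDelM : Delbourgo2002.mainTheorem_potMult)
    (hGZK : rank_eq_analyticRank_of_analyticRank_le_one) (hmod : hasEntireLFunction_rat)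
    (hmodD : nonempty_modularParametrizationData)
    (hΛ : ∀ (W : WeierstrassCurve ℚ) [W.IsElliptic] [W.IsGloballyMinimal] (p : ℕ) [Fact p.Prime],
      N10.CellM W p → W.analyticRank ≤ 1 →
      ∀ (V : WeierstrassCurve ℚ) [V.IsElliptic] [V.IsGloballyMinimal],
        (∃ C : VariableChange ℚ, C • V.quadraticTwist ((-1) ^ (p / 2) * p : ℚ) = W) →
          QuadraticBranchLowerDivisibilityAt V p)
    (hGZ : ∀ (W : WeierstrassCurve ℚ) [W.IsElliptic] [W.IsGloballyMinimal] (p : ℕ) [Fact p.Prime],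
      N10.CellM W p → W.analyticRank = 1 → ∀ Dh : PAdicHeightData W p, LeadingTermClauses W p Dh →
        SchneiderConjecture Dh ∧ BranchPAdicGrossZagierMultAt W p Dh) :
    Summit.BirchSwinnertonDyer.BirchSwinnertonDyer.Theses.AdditiveBranchIMC.MultLower :=
  multLower_of_lowerHalfM_of_facts_of_quadraticBranchLower_of_branchPAdicGrossZagierMult
    (lowerHalfM_of_facts_of_quadraticBranchLower hDelX hPal hGZK hmod hmodD
      fun W _ _ p _ hc hr => hΛ W p hc (by omega))
    hDelM hmod hmodD hGZK (fun W _ _ p _ hc hr => hΛ W p hc (by omega)) hGZ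

/-- **THE CRUX SHAPE, split by rank** (the form the glue of a tenure split `MultLower ⇐ facts ∧
(Λ-adic child) ∧ (rank-1 child)` consumes): the rank-`0` Λ-adic input and the rank-`1` inputs displayed
separately. [cite: Delbourgo1998, Main Conjecture (p. 151) (shape)] [cite: Delbourgo2002, Theorem (A), (B) (p. 40)]
[cite: Miller2011LMS, Def. 1.1] -/
theorem multLower_of_facts_of_rankZeroInput_of_rankOneInputs
    (hDelX : Delbourgo1998.prop4_rankZero_constantCoeff_eq_unit_mul_of_potMult)
    (hPal : Pal2012.thm32_sqrt_mul_realPeriodRat_twist_eq_of_prime_one_mod_four)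
    (hDelM : Delbourgo2002.mainTheorem_potMult)
    (hGZK : rank_eq_analyticRank_of_analyticRank_le_one) (hmod : hasEntireLFunction_rat)
    (hmodD : nonempty_modularParametrizationData)
    (hΛ₀ : ∀ (W : WeierstrassCurve ℚ) [W.IsElliptic] [W.IsGloballyMinimal] (p : ℕ) [Fact p.Prime],
      N10.CellM W p → W.analyticRank = 0 →
      ∀ (V : WeierstrassCurve ℚ) [V.IsElliptic] [V.IsGloballyMinimal],
        (∃ C : VariableChange ℚ, C • V.quadraticTwist ((-1) ^ (p / 2) * p : ℚ) = W) →
          QuadraticBranchLowerDivisibilityAt V p)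
    (hΛ₁ : ∀ (W : WeierstrassCurve ℚ) [W.IsElliptic] [W.IsGloballyMinimal] (p : ℕ) [Fact p.Prime],
      N10.CellM W p → W.analyticRank = 1 →
      ∀ (V : WeierstrassCurve ℚ) [V.IsElliptic] [V.IsGloballyMinimal],
        (∃ C : VariableChange ℚ, C • V.quadraticTwist ((-1) ^ (p / 2) * p : ℚ) = W) →
          QuadraticBranchLowerDivisibilityAt V p)
    (hGZ : ∀ (W : WeierstrassCurve ℚ) [W.IsElliptic] [W.IsGloballyMinimal] (p : ℕ) [Fact p.Prime],
      N10.CellM W p → W.analyticRank = 1 → ∀ Dh : PAdicHeightData W p, LeadingTermClauses W p Dh →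
        SchneiderConjecture Dh ∧ BranchPAdicGrossZagierMultAt W p Dh) :
    Summit.BirchSwinnertonDyer.BirchSwinnertonDyer.Theses.AdditiveBranchIMC.MultLower :=
  multLower_of_lowerHalfM_of_facts_of_quadraticBranchLower_of_branchPAdicGrossZagierMult
    (lowerHalfM_of_facts_of_quadraticBranchLower hDelX hPal hGZK hmod hmodD hΛ₀)
    hDelM hmod hmodD hGZK hΛ₁ hGZ

end Summit.BirchSwinnertonDyer.BirchSwinnertonDyer.Theorems.AdditiveBranchIMCMultLower

end
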